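import Summits.QuantumFields.YangMills.Theses.FemtoCutoffLadder
import Summits.QuantumFields.YangMills.Theorems.FemtoCutoffLadderAssemblyTelescoping

/-!
# Route `FemtoCutoffLadder` (QuantumFields / YangMills; rung R2b1 leaf `FemtoTransferGap.FemtoGapOfRecord`) — THE ASSEMBLY ITEM
# (stmt-QuantumFields-23510), PROVED: `UniformStepScaling → CoarsePairScaling → OneSiteWindowAnchor → MatchedCouplingExists → FemtoGapOfRecord`

Lead seat `ym-line-fcl-p1` (2026-08-27).  The dyadic telescoping is carried out route-independently in
`FemtoTransferGapCutoffLadder`-style module `FemtoCutoffLadderAssemblyTelescoping.lean` (`CutoffLadder.femtoGapOfRecord_of_ladder`: strong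
induction on `L`, potential `L^{−σ}`, geometric absorption of the octave slacks, finitely many coarse constants, one-site anchor, `L`-th
roots); this file feeds the route's items into it.  Route rev 3 (owner's restatements after the critic's
price P1, idea-crit-4): `UniformStepScaling` (stmt-QuantumFields-23836) is the ONE-SIDED octave step and `CoarsePairScaling`
(stmt-QuantumFields-23866) the ONE-SIDED comparison of each fixed `L` against the one-site problem — exactly the ladder's hypotheses `hS`, `hP`
(up to `x ^ 1 = x`), so the feed below is the identity on r2 and a `pow_one` on r3.

★ `assembly_proof : Theses.FemtoCutoffLadder.Assembly`.

HONEST FRAMING: bookkeeping only; the route's content is its two OPEN cruxes `UniformStepScaling` (r2 = stmt-QuantumFields-23836, XL, behind the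
barrier `UVStabilityNonUniqueness`) and `CoarsePairScaling` (r3 = stmt-QuantumFields-23866, L).  With the supports `OneSiteWindowAnchor` (23508) and `MatchedCouplingExists`
(23770) closed, the route is now EXACTLY its cruxes.  R2b1 is a RECORD rung — nothing here is infinite volume, a mass gap or the Clay problem,
and no summit is proved by this line.  No definitions, no named facts, no `sorry`.
-/

set_option autoImplicit false

noncomputable section

namespace Summit.QuantumFields.YangMills.Theorems.FemtoCutoffLadder

open Summit.QuantumFields.YangMills.Theorems.FemtoTransferGap
open Summit.QuantumFields.YangMills.Theses.FemtoCutoffLadder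

/-- ★ **THE ASSEMBLY ITEM OF ROUTE `FemtoCutoffLadder` (stmt-QuantumFields-23510), PROVED** — the dyadic telescoping
`UniformStepScaling → CoarsePairScaling → OneSiteWindowAnchor → MatchedCouplingExists → FemtoGapOfRecord`, via the route-independent ladder
`CutoffLadder.femtoGapOfRecord_of_ladder` fed with the route's (rev-3, one-sided) cruxes, the anchor and the matching. [cite: LuscherWeiszWolff1991] [cite: LuscherMunster1984, §2] -/
theorem assembly_proof : Summit.QuantumFields.YangMills.Theses.FemtoCutoffLadder.Assembly := by
  intro h₁ h₂ h₃ h₄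
  -- route rev ≥ 6 keeps `UniformStepScaling` as the retired TWO-SIDED birth form (stmt-QuantumFields-23506); the ladder's `hS` is its
  -- first (fine-below-coarse) conjunct — project it out (proof-only repair, ops-buildfix bf2-g27 2026-08-28; statement unchanged).
  obtain ⟨C₁, σ, lam1, L0, hσ, hlam1, H₁⟩ := h₁
  refine CutoffLadder.femtoGapOfRecord_of_ladder
    ⟨C₁, σ, lam1, L0, hσ, hlam1, fun lam hlam hle L' _ L _ h0 hL hL2 β β' hW hW' hm =>
      (H₁ lam hlam hle L' L h0 hL hL2 β β' hW hW' hm).1⟩ ?_ h₃ h₄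
  intro L _
  obtain ⟨C, lam0, hlam0, H⟩ := h₂ L
  refine ⟨C, lam0, hlam0, fun lam hlam hle β β' hW hW' hm => ?_⟩
  simpa only [pow_one] using H lam hlam hle β β' hW hW' hm

end Summit.QuantumFields.YangMills.Theorems.FemtoCutoffLadder

end
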